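import Summits.ABC.IUTFork.Joshi.ThetaEvaluationCollation
import Summits.ABC.IUTFork.Joshi.LogShellsBKModel
import HarnessLib

/-!
# [J-III] §9.7.4–9.7.5 à la Joshi — NON-VACUITY: an inhabited `ArithmeticoidDatum` whose global class `ξ_y` satisfies
# Prop. 9.7.2.3 at its (one) odd semistable place, and an inhabited `ClassCollationDatum` with non-empty collation `Ψ_Σ`

Block-E record file of the abc-iut cell (rung LADDER-ABC:A2.E; seat abc-iut-E-t21, slot T-21 follow-up; proof-only companion in the
pattern of the block's NV-MODEL files — audits flag «no model attempted»). Source typed: K. Joshi, arXiv:2401.13508**v4** (UNREFEREED;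
bib `Joshi2024ATS3`), §9.7.4 (9.7.4.1)–(9.7.4.2) and Prop. 9.7.5.1 (p.111 l.64–p.112 l.71) — the carriers `ATS3.ArithmeticoidDatum` /
`ATS3.ClassCollationDatum` of `ThetaEvaluationCollation` (p429631). INGREDIENTS (imported BY NAME): abc-iut-E-t19's MODEL of the §9.1.1
signature `BlochKatoDatum.model p` over `E = ℚ_p` (LogShellsBKModel p432045: `H¹ := ℚ_p ⊕ ℚ_p`, `κ(q) = (log_Iw q, v_p q)`) and its
`p*`-normalised §9.6–9.7 bridge `bkDatumNormalised` / `tateDatumNormalised` with `model_prop9723` (LogShellsBKBridgeNormalised p431396).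
TAKES NO SIDE on [IUTchIII] Cor. 3.12 or on Joshi's claims; a model exhibits SATISFIABILITY OF THE TYPING, nothing more; typed ≠ proved.

WHAT IS HERE. §1 `arithModel p hp2` — an `ArithmeticoidDatum` with ONE place (`V := Unit`) of kind `oddss` (odd `p`), `L′_w := ℚ_p`,
the normalised local Bloch–Kato datum of the model, `ℓ := 1`, `q^{1/2ℓ} := p`; DERIVED: its local Tate datum IS E-t19's
`tateDatumNormalised` (`arithModel_tateAt`, `rfl`), so its global class `ξ_y` at that place is the model's `ξ_w`
(`arithModel_xiGlobal`) and **Prop. 9.7.2.3 HOLDS there** (`arithModel_prop9723`) — the §9.7.4 carrier is inhabited by a datum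
satisfying the whole §9.6–9.7.2 chain. §2 `collationModel` — a `ClassCollationDatum` over one holomorphoid and one place with the
identity as the only admissible identification; DERIVED: its collation `Ψ_Σ` of any family of classes is the singleton of the
standard family (`collationModel_collation_eq`), in particular non-empty, and `Prop9751` holds (as it does by definition everywhere).
Standard axioms only; sorry-free; no Joshi claim is asserted.
-/

noncomputable section

open Set

namespace Summit.ABC.IUTFork.Joshi.ATS3

open Summit.ABC.IUTFork.Joshi (BlochKatoDatum)

variable (p : ℕ) [Fact p.Prime]

/-! ## 1. An inhabited `ArithmeticoidDatum` (9.7.4) satisfying Prop. 9.7.2.3 at its odd semistable place -/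

/-- **NV MODEL of the §9.7.4 carrier**: one place, of kind `oddss`; `L′_w := ℚ_p` with E-t19's model cohomology and its `p*`-normalised
local Bloch–Kato datum; `ℓ := 1`; `q^{1/2ℓ} := p` (`‖p‖ < 1`, `p ≠ 0`); no archimedean place (the Schottky field is vacuous). [folklore] -/
def arithModel (hp2 : p ≠ 2) :
    ArithmeticoidDatum Unit (fun _ => ℚ_[p]) (fun _ => ↥(BlochKatoDatum.model p).HZ) (fun _ => ℚ_[p] × ℚ_[p]) where
  kind _ := .oddss
  bk _ _ := (BlochKatoDatum.model p).bkDatumNormalised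
  l := 1
  one_le_l := le_rfl
  p_ne_two _ _ := hp2
  q2l _ _ := (p : ℚ_[p])
  q2l_ne_zero _ _ := Nat.cast_ne_zero.2 (Fact.out : p.Prime).ne_zero
  norm_q2l_lt_one _ _ := Padic.norm_p_lt_one
  qSchottky _ h := PlaceKind.noConfusion h

variable (hp2 : p ≠ 2)

/-- The model's local Tate datum at its place IS E-t19's normalised model Tate datum with `ℓ = 1`, `q^{1/2ℓ} = p`. [folklore] -/
theorem arithModel_tateAt :
    (arithModel p hp2).tateAt () rfl =
      (BlochKatoDatum.model p).tateDatumNormalised hp2 1 le_rfl (p : ℚ_[p])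
        (Nat.cast_ne_zero.2 (Fact.out : p.Prime).ne_zero) Padic.norm_p_lt_one := rfl

/-- The model's global class `ξ_y` at its (odd semistable) place is the local class `ξ_w = κ(1 + p*·q^{1/2ℓ})` of 9.6.2
((9.7.4.2), second case). [folklore] -/
theorem arithModel_xiGlobal :
    (arithModel p hp2).xiGlobal () = ((arithModel p hp2).tateAt () rfl).xiClass :=
  (arithModel p hp2).xiGlobal_of_oddss () rfl

/-- **Prop. 9.7.2.3 HOLDS at the model's place** (both clauses: `I = log_BK(H¹_e(ℤ_p(1)))` and `log_BK(ξ_w) ∈ I`), by E-t19's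
`model_prop9723` — the §9.7.4 carrier is inhabited by a datum satisfying the whole typed §9.6–9.7.2 chain. NON-VACUITY of the typing;
nothing about Galois cohomology is claimed. [folklore] -/
theorem arithModel_prop9723 : ((arithModel p hp2).tateAt () rfl).Prop9723 := by
  rw [arithModel_tateAt]
  exact BlochKatoDatum.model_prop9723 p hp2 1 le_rfl _ _ _

/-- Lemma 9.6.2.2 (`XiCrystalline`) holds at the model's place. [folklore] -/
theorem arithModel_xiCrystalline : ((arithModel p hp2).tateAt () rfl).XiCrystalline := by
  rw [arithModel_tateAt]
  exact (BlochKatoDatum.model p).tateDatumNormalised_xiCrystalline hp2 1 le_rfl _ _ _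

/-- (9.7.2.2) (`LogBKXiFormula`, the displayed value) holds at the model's place (normalised `e_BK`). [folklore] -/
theorem arithModel_logBKXiFormula : ((arithModel p hp2).tateAt () rfl).LogBKXiFormula := by
  rw [arithModel_tateAt]
  exact (BlochKatoDatum.model p).tateDatumNormalised_logBKXiFormula hp2 1 le_rfl _ _ _

/-- The model has no archimedean and no «other» place: every place is odd semistable. [folklore] -/
theorem arithModel_kind (w : Unit) : (arithModel p hp2).kind w = .oddss := rfl

/-- `V_{L′,p}` of the model is everything (its one place lies over `p`). [folklore] -/
theorem arithModel_placesOver : (arithModel p hp2).placesOver p = univ := by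
  ext w
  simp only [mem_univ, iff_true]
  exact ⟨PlaceKind.ne_arc_of_eq_oddss rfl, rfl⟩

/-- **The §9.7.4 carrier is inhabited (odd `p`) by a datum whose class at an odd semistable place satisfies Prop. 9.7.2.3.** [folklore] -/
theorem exists_arithmeticoidDatum_prop9723 (hp2 : p ≠ 2) :
    ∃ A : ArithmeticoidDatum Unit (fun _ => ℚ_[p]) (fun _ => ↥(BlochKatoDatum.model p).HZ) (fun _ => ℚ_[p] × ℚ_[p]),
      ∃ h : A.kind () = .oddss, (A.tateAt () h).Prop9723 :=
  ⟨arithModel p hp2, rfl, arithModel_prop9723 p hp2⟩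

/-! ## 2. An inhabited `ClassCollationDatum` (9.7.5) with non-empty collation -/

/-- **NV MODEL of the Prop. 9.7.5.1 carrier**: one holomorphoid (the standard one), one place, factors `H := HZ` of the model, and the
identity as the only admissible identification («isomorphisms given by [ATS II½] Prop. 7.4.1» — at `y = y₀` the identity is one).
[folklore] -/
def collationModel : ClassCollationDatum Unit Unit (fun _ _ => ↥(BlochKatoDatum.model p).HZ) where
  std := ()
  iso _ _ := {Equiv.refl _}

/-- In the model every admissible identification is the identity. [folklore] -/
theorem collationModel_iso (y w : Unit) : (collationModel p).iso y w = {Equiv.refl _} := rfl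

/-- **The model's collation of a family of classes is the singleton of the standard family** (reading R1): `Ψ_Σ = {ξ_{y₀}}` for
`Σ = {y₀}`. DERIVED. [folklore] -/
theorem collationModel_collation_eq {A : Type*} (ξ : Unit → A → Unit → ↥(BlochKatoDatum.model p).HZ) :
    (collationModel p).collation univ ξ = {ξ ()} := by
  ext f
  constructor
  · rintro ⟨y, -, φ, hφ, hf⟩
    obtain ⟨⟩ := y
    have hφ' : ∀ w, φ w = Equiv.refl _ := fun w => hφ w
    refine funext fun a => funext fun w => ?_
    rw [hf a w, hφ' w]
    rfl
  · rintro rfl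
    exact (collationModel p).self_mem_collation univ ξ (mem_univ _) fun _ => rfl

/-- Hence the model's collation is non-empty. [folklore] -/
theorem collationModel_collation_nonempty {A : Type*} (ξ : Unit → A → Unit → ↥(BlochKatoDatum.model p).HZ) :
    ((collationModel p).collation univ ξ).Nonempty := by
  rw [collationModel_collation_eq]; exact singleton_nonempty _

/-- Prop. 9.7.5.1 holds for the model (as it does over every datum, by definition). [folklore] -/
theorem collationModel_prop9751 {A : Type*} (ξ : Unit → A → Unit → ↥(BlochKatoDatum.model p).HZ) :
    (collationModel p).Prop9751 univ ξ :=
  (collationModel p).prop9751_holds univ ξ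

/-- **Both §9.7.4–9.7.5 carriers are inhabited** (odd `p`), with the global class of the first feeding the collation of the second:
collating the model's `ξ_y` (as a one-slot family) gives exactly `{ξ_y}`. [folklore] -/
theorem collation_of_arithModel_xiGlobal :
    (collationModel p).collation univ (fun _ (_ : Unit) w => (arithModel p hp2).xiGlobal w) =
      {fun (_ : Unit) w => (arithModel p hp2).xiGlobal w} :=
  collationModel_collation_eq p _

end Summit.ABC.IUTFork.Joshi.ATS3

end
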